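import Summits.QuantumFields.YangMills.Theorems.FluctuationComparisonRegPrIntLS2BetaChartContChain
import Summits.QuantumFields.YangMills.Theorems.FluctuationComparisonRegPrIntLWregFibredChart
import Literature.MathematicalPhysics.QuantumFieldTheory.Balaban1983to89.BlockAveragingCentralBlind
import HarnessLib

/-!
# CHART∞ · IV-a (LINE g18-1 `semiclassical_s2beta`, organ S2β, LAPLACE row): the chain's forward-law density made BLIND TO THE PIVOT ENTRIES

R3 = Balaban's UV-stability programme on the finite 3-torus, gauge group `SU(N)` (generic `(P, N)` here) — NOT d = 4, NOT infinite volume, NOT a mass gap,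
NOT Clay; the Yang–Mills gap is NOT proved by anything in this file.  Helper toward crux `stmt-QuantumFields-20520` (`FluctuationComparisonRegPrIntL`),
LINE g18-1, LAPLACE row, letter CHART∞ (IV): the door (`…S2BetaLaplaceLimitOn`, w4-20520 g15) and its instantiation (`…S2BetaLaplaceInst`, w5-20520 g13) integrate
over the FULL fine field space with the pivot-translation symmetry `pivotAct`; every CHART∞ object must therefore be blind to the pivot entries
`z (iterCentralBond n c)`.  The chart `Φ`, the image windows `T` and the inverse `ϑ` are (✓`chainMap_extend`, ✓`chainWindow_extend`); the chain DENSITY of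
Parts I–III is an `∃` over N09's one-step Jacobian whose (blind) formula is hidden.  This file normalises it:

* §1 `extendOne_extend`, `fibreFamily_extend_centralBond`, ★`centralWindowSet_extend_centralBond`, `avgFun_update_extendOne` — the one-step window and the one-step
  map at `c` are blind to resampling ALL level-`j` private coordinates `W (centralBond c')` (tree ✓`BlockAveragingCentralBlind`, ✓`isLocal_avgFun` + `apply_resample_eq`);
* §2 ★★`exists_jacobian_forwardLaws_lb_graph_blind` — Part I's ✓`exists_jacobian_forwardLaws_lb_graph` (six conjuncts VERBATIM) for the NORMALISED Jacobian
  `jac' c W h := jac c (extend centralBond 1 W) h`, plus (7) `jac' c (extend centralBond g W) h = jac' c W h`;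
* §3 ★★`chain_forwardLaw_contOn_blind` — Part I's ✓`chain_forwardLaw_contOn` (seven conjuncts VERBATIM) plus (8) `J (extend (iterCentralBond n) g U) h = J U h`.
Parts IV-b∕IV-c re-run II∕III on §3 and transfer the continuity of `(Φ_V, Jac_V)` along pivot translations to the `pivotAct`-invariant set
`{z | (∀ c, V c ∈ T c z) ∧ small history of Φ_V z}`.
-/

noncomputable section

open MeasureTheory Filter Topology Set Function
open scoped ENNReal NNReal
open Literature.MathematicalPhysics.QuantumFieldTheory.Balaban1983to89
open Literature.MathematicalPhysics.QuantumFieldTheory.Balaban1983to89.T4Continuum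
open Literature.MathematicalPhysics.QuantumFieldTheory.Balaban1983to89.BlockAveraging (Idx avgFun measurable_avgFun loopHol)
open Literature.MathematicalPhysics.QuantumFieldTheory.Balaban1983to89.BlockAveragingHaarAC (centralBond centralBond_injective isLocal_avgFun pre post IsCentral openHol)
open Literature.MathematicalPhysics.QuantumFieldTheory.Balaban1983to89.BlockAveragingEMLHaarAC (fibreFamily offCard fibreMap FibreSmall avgFun_update_centralBond_self)
open Literature.MathematicalPhysics.QuantumFieldTheory.Balaban1983to89.BlockAveragingCentralBlind (openHol_extend_centralBond pre_extend_centralBond post_extend_centralBond)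
open Literature.MathematicalPhysics.QuantumFieldTheory.Balaban1983to89.ExpMeanLog (expMeanLogSU deltaSU deltaSU_pos measurable_expMeanLogSU_E)
open Literature.MathematicalPhysics.QuantumFieldTheory.Balaban1983to89.Node00 (SU)
open Summit.QuantumFields.YangMills.BalabanUVNodes.N09CentralWindowAtRecord (avgFun_update_centralBond_injOn_centralWindow self_mem_centralWindow_iff)
open Summit.QuantumFields.YangMills.BalabanUVNodes.N09CentralWindowChart (fibreSmall_of_mem_window)
open Summit.QuantumFields.YangMills.Theorems.FluctuationComparisonRegPrIntLWregChain
open Summit.QuantumFields.YangMills.Theorems.FluctuationComparisonRegPrIntLWregChartChainBlindness (update_extend_eq extend_comp_eq)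
open Summit.QuantumFields.YangMills.Theorems.FluctuationComparisonRegPrIntLWregFibredChart (chainMap_extend iter_extend_eq chainWindow_extend)
open Summit.QuantumFields.YangMills.Theorems.FluctuationComparisonRegPrIntLWregChartChargeOneStep (continuousAt_fibreMap₂_of_fibreSmall)
open Summit.QuantumFields.YangMills.Theorems.FluctuationComparisonRegPrIntLWregChartCharge (continuousAt_iter_of_loopSmall)
open Summit.QuantumFields.YangMills.Theorems.FluctuationComparisonRegPrIntLS2BetaChartContChain

namespace Summit.QuantumFields.YangMills.Theorems.FluctuationComparisonRegPrIntLS2BetaChartContBlindChain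

variable {P : Params} {N : ℕ} [NeZero N]

/-! ## §1 Blindness of the one-step data to resampling the private coordinates -/

omit [NeZero N] in
/-- Normalising the private coordinates after resampling them = normalising them. [cite: Balaban1987RG1, (0.4) p.253 (bookkeeping)] -/
theorem extendOne_extend {j : ℕ} (g : PBond P (j + 1) → SU N) (W : GaugeField P j (SU N)) :
    extend (centralBond : PBond P (j + 1) → PBond P j) (fun _ => (1 : SU N)) (extend centralBond g W) =
      extend (centralBond : PBond P (j + 1) → PBond P j) (fun _ => (1 : SU N)) W := by
  funext b
  by_cases hb : ∃ c : PBond P (j + 1), centralBond c = b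
  · rw [Function.extend_def, dif_pos hb, Function.extend_def, dif_pos hb]
  · rw [Function.extend_def, dif_neg hb, Function.extend_def, dif_neg hb, Function.extend_def, dif_neg hb]

omit [NeZero N] in
/-- The normalisation `W ↦ extend centralBond 1 W` is continuous. [cite: Balaban1987RG1, (0.4) p.253 (bookkeeping)] -/
theorem continuous_extendOne {j : ℕ} :
    Continuous fun W : GaugeField P j (SU N) => extend (centralBond : PBond P (j + 1) → PBond P j) (fun _ => (1 : SU N)) W := by
  refine continuous_pi fun b => ?_
  by_cases hb : ∃ c : PBond P (j + 1), centralBond c = b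
  · simp only [Function.extend_def, dif_pos hb]; exact continuous_const
  · simp only [Function.extend_def, dif_neg hb]; exact continuous_apply b

omit [NeZero N] in
/-- The normalisation `W ↦ extend centralBond 1 W` is measurable. [cite: Balaban1987RG1, (0.4) p.253 (bookkeeping)] -/
theorem measurable_extendOne {j : ℕ} :
    Measurable fun W : GaugeField P j (SU N) => extend (centralBond : PBond P (j + 1) → PBond P j) (fun _ => (1 : SU N)) W := by
  refine measurable_pi_lambda _ fun b => ?_
  by_cases hb : ∃ c : PBond P (j + 1), centralBond c = b
  · simp only [Function.extend_def, dif_pos hb]; exact measurable_const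
  · simp only [Function.extend_def, dif_neg hb]; exact measurable_pi_apply b

/-- The W-coordinate family at `c` is blind to resampling all private coordinates (off-central: ✓`openHol_extend_centralBond`; central: the constant `1`).
[cite: Balaban1987RG1, (0.4) p.253 (bookkeeping)] -/
theorem fibreFamily_extend_centralBond {j : ℕ} (hj : j + 1 ≤ P.m + P.K) (W : GaugeField P j (SU N)) (c : PBond P (j + 1))
    (g : PBond P (j + 1) → SU N) (x : SU N) (i : Idx P) :
    fibreFamily (extend centralBond g W) c x i = fibreFamily W c x i := by
  classical
  by_cases hi : IsCentral c i
  · simp only [fibreFamily, if_pos hi]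
  · simp only [fibreFamily, if_neg hi, openHol_extend_centralBond hj W c i hi g]

/-- ★ **THE ONE-STEP CENTRAL WINDOW IS BLIND TO RESAMPLING ALL PRIVATE COORDINATES.** [cite: Balaban1987RG1, (0.4) p.253 and (2.9) p.266 (bookkeeping)] -/
theorem centralWindowSet_extend_centralBond {j : ℕ} (hj : j + 1 ≤ P.m + P.K) (W : GaugeField P j (SU N)) (c : PBond P (j + 1))
    (g : PBond P (j + 1) → SU N) (α : ℝ) :
    centralWindowSet (extend centralBond g W) c α = centralWindowSet W c α := by
  classical
  ext h
  simp only [centralWindowSet, mem_setOf_eq, pre_extend_centralBond hj, post_extend_centralBond hj, fibreFamily_extend_centralBond hj]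

/-- The one-step (0.4) map at `c` is blind to normalising the private coordinates (`update_extend_eq` + `apply_resample_eq` on ✓`isLocal_avgFun`).
[cite: Balaban1987RG1, (0.4) p.253 (bookkeeping)] -/
theorem avgFun_update_extendOne {j : ℕ} (hj : j + 1 ≤ P.m + P.K) (W : GaugeField P j (SU N)) (c : PBond P (j + 1)) (h : SU N) :
    avgFun (expMeanLogSU (n := Fin N)) (update (extend centralBond (fun _ => (1 : SU N)) W) (centralBond c) h) c =
      avgFun (expMeanLogSU (n := Fin N)) (update W (centralBond c) h) c := by
  classical
  have hcb : Injective (centralBond : PBond P (j + 1) → PBond P j) := centralBond_injective hj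
  rw [update_extend_eq hcb, T4TriangularPushforward.apply_resample_eq (isLocal_avgFun hj (expMeanLogSU (n := Fin N))) hcb, update_self]

/-! ## §2 The normalised one-step Jacobian -/

/-- ★★ **N09's ONE-STEP JACOBIAN, NORMALISED TO BE BLIND TO THE PRIVATE COORDINATES**: ✓`exists_jacobian_forwardLaws_lb_graph` (Part I; six conjuncts VERBATIM) for
`jac' c W h := jac c (extend centralBond 1 W) h`, plus (7) `jac' c (extend centralBond g W) h = jac' c W h` — the window, the one-step map and hence the
forward law at `W` and at its normalisation coincide (§1). [cite: Balaban1987RG1, (0.4) p.253 and (2.10) p.267; Balaban1985Averaging, Prop. 1 p.25] -/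
theorem exists_jacobian_forwardLaws_lb_graph_blind {j : ℕ} (hj : j + 1 ≤ P.m + P.K) {α : ℝ} (hα0 : 0 ≤ α) (hα24 : α ≤ 1 / 24)
    (hα64 : 64 * α ≤ deltaSU (Fin N)) (hαL : 157 * α < ((P.L : ℝ) ^ (P.d - 1))⁻¹)
    (hgap : ∀ c : PBond P (j + 1), (offCard c : ℝ) / (Fintype.card (Idx P) : ℝ) + 150 * α < 1)
    {j₀ : ℝ≥0} (hvol : j₀ = 0 ∨ ChainVol P N α j₀) :
    ∃ jac : PBond P (j + 1) → GaugeField P j (SU N) → SU N → ℝ≥0,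
      (∀ c, Measurable fun p : GaugeField P j (SU N) × SU N => jac c p.1 p.2) ∧
      (∀ c U g, g ∈ centralWindowSet U c α → jac c U g ≠ 0) ∧
      (∀ c U, (HaarData.haar : Measure (SU N)).restrict
          ((fun g : SU N => avgFun (expMeanLogSU (n := Fin N)) (update U (centralBond c) g) c) '' centralWindowSet U c α) =
        (((HaarData.haar : Measure (SU N)).restrict (centralWindowSet U c α)).withDensity fun g => (jac c U g : ℝ≥0∞)).map
          (fun g : SU N => avgFun (expMeanLogSU (n := Fin N)) (update U (centralBond c) g) c)) ∧
      (∀ c U, ContinuousOn (jac c U) (centralWindowSet U c α)) ∧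
      (∀ c U g, j₀ ≤ jac c U g) ∧
      (∀ c, ContinuousOn (fun p : GaugeField P j (SU N) × SU N => jac c p.1 p.2)
        {p : GaugeField P j (SU N) × SU N | p.2 ∈ centralWindowSet p.1 c α}) ∧
      (∀ c U (g : PBond P (j + 1) → SU N) h, jac c (extend centralBond g U) h = jac c U h) := by
  classical
  obtain ⟨jac, hm, h0, hlaw, hc, hlb, hg⟩ := exists_jacobian_forwardLaws_lb_graph (N := N) (P := P) hj hα0 hα24 hα64 hαL hgap hvol
  refine ⟨fun c W h => jac c (extend centralBond (fun _ => (1 : SU N)) W) h, fun c => ?_, fun c U g hg' => ?_, fun c U => ?_, fun c U => ?_,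
    fun c U g => hlb c _ g, fun c => ?_, fun c U g h => ?_⟩
  · exact (hm c).comp ((measurable_extendOne.comp measurable_fst).prodMk measurable_snd)
  · exact h0 c _ g (by rwa [centralWindowSet_extend_centralBond hj])
  · have h := hlaw c (extend centralBond (fun _ => (1 : SU N)) U)
    have hF : (fun g : SU N => avgFun (expMeanLogSU (n := Fin N)) (update (extend centralBond (fun _ => (1 : SU N)) U) (centralBond c) g) c) =
        fun g : SU N => avgFun (expMeanLogSU (n := Fin N)) (update U (centralBond c) g) c := funext fun g => avgFun_update_extendOne hj U c g
    rw [centralWindowSet_extend_centralBond hj, hF] at h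
    exact h
  · rw [← centralWindowSet_extend_centralBond hj U c (fun _ => (1 : SU N))]
    exact hc c _
  · refine (hg c).comp ((continuous_extendOne.comp continuous_fst).prodMk continuous_snd).continuousOn fun p hp => ?_
    show p.2 ∈ centralWindowSet (extend centralBond (fun _ => (1 : SU N)) p.1) c α
    rw [centralWindowSet_extend_centralBond hj]
    exact hp
  · show jac c (extend centralBond (fun _ => (1 : SU N)) (extend centralBond g U)) h = jac c (extend centralBond (fun _ => (1 : SU N)) U) h
    rw [extendOne_extend]

/-! ## §3 The pivot-blind chain density -/

/-- ★★ **THE CHAIN'S FORWARD-LAW DENSITY — PIVOT-BLIND EDITION**: ✓`chain_forwardLaw_contOn` (Part I) VERBATIM on the pivot-blind one-step Jacobian ✓`exists_jacobian_forwardLaws_lb_graph_blind`, with an eighth conjunct: `J (extend (iterCentralBond n) g U) h = J U h` — the chain density is BLIND TO RESAMPLING THE PIVOTS (`extend_comp_eq`, ✓`iter_extend_eq`, ✓`chainMap_extend`).  ORIGINAL DOCSTRING: the induction of ✓`chain_forwardLaw_lb` (F1c)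
VERBATIM (same six conjuncts, same `hvol`) on the one-step Jacobian of ✓`exists_jacobian_forwardLaws_lb_graph` (continuous on the one-step GRAPH), carrying
the extra conjunct: the chain density `(U, g) ↦ J U g` is JOINTLY continuous on the guarded window graph `{(U, g) : U has small loop history below
level n (`Ū⁽ᵏ⁾(U)`, `k < n`, loop variables `≤ α`) ∧ g ∈ chainWindow α n U c}` — by ✓`continuousAt_chainMap₂`, ✓`continuousAt_iter_of_loopSmall` and
`ContinuousOn.comp` into the one-step graph (second clause of ✓`chainWindow_succ`).  This is the measure-side input of CHART∞ (continuity of the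
fibre amplitude `a_V` in the environment `V`).  [cite: Balaban1987RG1, (0.4) p.253; Balaban1985Averaging, Prop. 1 p.25] -/
theorem chain_forwardLaw_contOn_blind {α : ℝ} (hα0 : 0 ≤ α) (hα24 : α ≤ 1 / 24) (hα64 : 64 * α ≤ deltaSU (Fin N))
    (hαL : 157 * α < ((P.L : ℝ) ^ (P.d - 1))⁻¹)
    (hgap : ∀ j (c : PBond P (j + 1)), (offCard c : ℝ) / (Fintype.card (Idx P) : ℝ) + 150 * α < 1)
    {j₀ : ℝ≥0} (hvol : j₀ = 0 ∨ ChainVol P N α j₀) (n : ℕ) :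
    n ≤ P.m + P.K → ∀ c : PBond P n, ∃ J : GaugeField P 0 (SU N) → SU N → ℝ≥0,
      (Measurable fun p : GaugeField P 0 (SU N) × SU N => J p.1 p.2) ∧
      (∀ U, ∀ g ∈ chainWindow α n U c, J U g ≠ 0) ∧
      (∀ U, (HaarData.haar : Measure (SU N)).restrict (chainMap (expMeanLogSU (n := Fin N)) n U c '' chainWindow α n U c) =
        (((HaarData.haar : Measure (SU N)).restrict (chainWindow α n U c)).withDensity fun g => (J U g : ℝ≥0∞)).map
          (chainMap (expMeanLogSU (n := Fin N)) n U c)) ∧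
      (∀ U, ContinuousOn (J U) (chainWindow α n U c)) ∧
      (∀ U g, j₀ ^ n ≤ J U g) ∧
      ContinuousOn (fun p : GaugeField P 0 (SU N) × SU N => J p.1 p.2)
        {p : GaugeField P 0 (SU N) × SU N |
          (∀ k, k < n → ∀ (c' : PBond P (k + 1)) (i : Idx P),
            dist1 (loopHol (Averaging.iter (fun i => BlockAveraging.blockAvg (P := P) (j := i) (expMeanLogSU (n := Fin N))) k p.1) c' i) ≤ α) ∧
          p.2 ∈ chainWindow (N := N) α n p.1 c} ∧
      (∀ (U : GaugeField P 0 (SU N)) (g : PBond P n → SU N) (h : SU N), J (extend (iterCentralBond n) g U) h = J U h) := by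
  have hαδ : α < deltaSU (Fin N) := by nlinarith [deltaSU_pos (n := Fin N)]
  induction n with
  | zero =>
      intro _ c
      refine ⟨fun _ _ => 1, measurable_const, fun _ _ _ => one_ne_zero, fun U => ?_, fun U => continuousOn_const, fun U g => by rw [pow_zero],
        continuousOn_const, fun _ _ _ => rfl⟩
      have hid : chainMap (expMeanLogSU (n := Fin N)) 0 U c = id := funext fun g => chainMap_zero _ U c g
      have hW0 : chainWindow α 0 U c = Set.univ := rfl
      rw [hid, hW0, Set.image_id, Measure.map_id, Measure.restrict_univ]
      have h1 : (fun _ : SU N => (((1 : ℝ≥0) : ℝ≥0) : ℝ≥0∞)) = 1 := funext fun _ => ENNReal.coe_one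
      rw [h1, withDensity_one]
  | succ n ih =>
      intro hn c
      obtain ⟨J, hJm, hJ0, hJlaw, hJc, hJlb, hJw, hJbl⟩ := ih (by omega) (centralBond c)
      obtain ⟨jac, hjacm, hjac0, hfwd, hjc, hjlb, hjg, hjbl⟩ :=
        exists_jacobian_forwardLaws_lb_graph_blind (N := N) (P := P) (j := n) (by omega) hα0 hα24 hα64 hαL (hgap n) hvol
      have jacm : ∀ (W : GaugeField P n (SU N)), Measurable (jac c W) := fun W =>
        (hjacm c).comp (measurable_const.prodMk measurable_id)
      have hiter := T4Continuum.measurable_iter (fun i => BlockAveraging.blockAvg (P := P) (j := i) (expMeanLogSU (n := Fin N)))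
        (fun j => by rw [BlockAveraging.blockAvg_avg]; exact measurable_avgFun _ measurable_expMeanLogSU_E) n
      refine ⟨fun U g => J U g * jac c (Averaging.iter (fun i => BlockAveraging.blockAvg (P := P) (j := i) (expMeanLogSU (n := Fin N))) n U)
          (chainMap (expMeanLogSU (n := Fin N)) n U (centralBond c) g), ?_, fun U g hg => ?_, fun U => ?_, fun U => ?_,
          fun U g => by rw [pow_succ]; exact mul_le_mul' (hJlb U g) (hjlb c _ _), ?_, fun U g h => ?blind⟩
      case blind =>
        -- resampling the level-`(n+1)` pivots = resampling the level-`n` pivots at the images of `centralBond`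
        have hβ := iterCentralBond_injective (P := P) (n := n) (by omega)
        have hcb : Injective (centralBond : PBond P (n + 1) → PBond P n) := centralBond_injective (by omega)
        have hE : extend (iterCentralBond (n + 1)) g U = extend (iterCentralBond n) (extend centralBond g (U ∘ iterCentralBond n)) U :=
          extend_comp_eq hβ hcb g U
        show J (extend (iterCentralBond (n + 1)) g U) h *
            jac c (Averaging.iter (fun i => BlockAveraging.blockAvg (P := P) (j := i) (expMeanLogSU (n := Fin N))) n (extend (iterCentralBond (n + 1)) g U))
              (chainMap (expMeanLogSU (n := Fin N)) n (extend (iterCentralBond (n + 1)) g U) (centralBond c) h) =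
          J U h * jac c (Averaging.iter (fun i => BlockAveraging.blockAvg (P := P) (j := i) (expMeanLogSU (n := Fin N))) n U)
            (chainMap (expMeanLogSU (n := Fin N)) n U (centralBond c) h)
        rw [iter_extend_eq _ hn g U, hjbl, hE, hJbl, chainMap_extend _ (show n ≤ P.m + P.K by omega)]
      · exact hJm.mul ((hjacm c).comp ((hiter.comp measurable_fst).prodMk (measurable_chainMap₂ n (centralBond c))))
      · exact mul_ne_zero (hJ0 U g hg.1) (hjac0 c _ _ hg.2)
      rotate_left
      · rw [chainWindow_succ]
        have hf := continuousOn_chainMap (N := N) hαδ (n := n) (by omega) U (centralBond c)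
        exact ((hJc U).mono inter_subset_left).mul ((hjc c _).comp (hf.mono inter_subset_left) fun g hg => hg.2)
      · -- joint continuity on the guarded window graph
        have hsub : {p : GaugeField P 0 (SU N) × SU N |
              (∀ k, k < n + 1 → ∀ (c' : PBond P (k + 1)) (i : Idx P),
                dist1 (loopHol (Averaging.iter (fun i => BlockAveraging.blockAvg (P := P) (j := i) (expMeanLogSU (n := Fin N))) k p.1) c' i) ≤ α) ∧
              p.2 ∈ chainWindow (N := N) α (n + 1) p.1 c} ⊆
            {p : GaugeField P 0 (SU N) × SU N |
              (∀ k, k < n → ∀ (c' : PBond P (k + 1)) (i : Idx P),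
                dist1 (loopHol (Averaging.iter (fun i => BlockAveraging.blockAvg (P := P) (j := i) (expMeanLogSU (n := Fin N))) k p.1) c' i) ≤ α) ∧
              p.2 ∈ chainWindow (N := N) α n p.1 (centralBond c)} := fun p hp => by
          refine ⟨fun k hk => hp.1 k (by omega), ?_⟩
          have h2 := hp.2
          rw [chainWindow_succ] at h2
          exact h2.1
        have h1 := hJw.mono hsub
        have hinner : ContinuousOn (fun p : GaugeField P 0 (SU N) × SU N =>
            ((Averaging.iter (fun i => BlockAveraging.blockAvg (P := P) (j := i) (expMeanLogSU (n := Fin N))) n p.1,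
              chainMap (expMeanLogSU (n := Fin N)) n p.1 (centralBond c) p.2) : GaugeField P n (SU N) × SU N))
            {p : GaugeField P 0 (SU N) × SU N |
              (∀ k, k < n + 1 → ∀ (c' : PBond P (k + 1)) (i : Idx P),
                dist1 (loopHol (Averaging.iter (fun i => BlockAveraging.blockAvg (P := P) (j := i) (expMeanLogSU (n := Fin N))) k p.1) c' i) ≤ α) ∧
              p.2 ∈ chainWindow (N := N) α (n + 1) p.1 c} := fun p hp =>
          (((continuousAt_iter_of_loopSmall (N := N) hαδ p.1 (hsub hp).1).comp_of_eq continuousAt_fst rfl).prodMk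
            (continuousAt_chainMap₂ (P := P) (N := N) hαδ (n := n) (by omega) (centralBond c) p.1 p.2 (hsub hp).1 (hsub hp).2)).continuousWithinAt
        have hmaps : MapsTo (fun p : GaugeField P 0 (SU N) × SU N =>
            ((Averaging.iter (fun i => BlockAveraging.blockAvg (P := P) (j := i) (expMeanLogSU (n := Fin N))) n p.1,
              chainMap (expMeanLogSU (n := Fin N)) n p.1 (centralBond c) p.2) : GaugeField P n (SU N) × SU N))
            {p : GaugeField P 0 (SU N) × SU N |
              (∀ k, k < n + 1 → ∀ (c' : PBond P (k + 1)) (i : Idx P),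
                dist1 (loopHol (Averaging.iter (fun i => BlockAveraging.blockAvg (P := P) (j := i) (expMeanLogSU (n := Fin N))) k p.1) c' i) ≤ α) ∧
              p.2 ∈ chainWindow (N := N) α (n + 1) p.1 c}
            {p : GaugeField P n (SU N) × SU N | p.2 ∈ centralWindowSet p.1 c α} :=
          fun p hp => by
            have h2 := hp.2
            rw [chainWindow_succ] at h2
            exact h2.2
        have h2 := (hjg c).comp hinner hmaps
        exact h1.mul h2
      · -- `chainMap (n+1) = F ∘ f`, `chainWindow (n+1) = W ∩ f⁻¹ Ω`
        set env : GaugeField P n (SU N) := Averaging.iter (fun i => BlockAveraging.blockAvg (P := P) (j := i) (expMeanLogSU (n := Fin N))) n U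
          with henv
        set f := chainMap (expMeanLogSU (n := Fin N)) n U (centralBond c) with hfdef
        have hcomp : chainMap (expMeanLogSU (n := Fin N)) (n + 1) U c =
            (fun g => avgFun (expMeanLogSU (n := Fin N)) (update env (centralBond c) g) c) ∘ f := funext fun g => chainMap_succ _ hn U c g
        have hW' : chainWindow α (n + 1) U c = chainWindow α n U (centralBond c) ∩ f ⁻¹' centralWindowSet env c α :=
          chainWindow_succ α n U c
        have hFm : Measurable (fun g => avgFun (expMeanLogSU (n := Fin N)) (update env (centralBond c) g) c) :=
          (measurable_pi_apply c).comp ((measurable_avgFun _ measurable_expMeanLogSU_E).comp (measurable_update _))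
        have hinjF : InjOn (fun g => avgFun (expMeanLogSU (n := Fin N)) (update env (centralBond c) g) c) (centralWindowSet env c α) :=
          fun g₁ hg₁ g₂ hg₂ h => avgFun_update_centralBond_injOn_centralWindow (by omega) _ c hα0 hα24 hαδ (hgap n c) hg₁ hg₂ h
        have hFS : MeasurableSet ((fun g => avgFun (expMeanLogSU (n := Fin N)) (update env (centralBond c) g) c) ''
            (f '' chainWindow α n U (centralBond c) ∩ centralWindowSet env c α)) := by
          rw [← Set.image_inter_preimage, ← Set.image_comp, ← hcomp, ← hW']
          exact measurableSet_image_chainWindow hα0 hα24 hαδ hgap hn U c (measurableSet_chainWindow α (n + 1) U c) subset_rfl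
        have key := forwardLaw_comp (HaarData.haar : Measure (SU N)) (HaarData.haar : Measure (SU N)) (HaarData.haar : Measure (SU N))
          (measurable_chainMap n U (centralBond c)) hFm (measurableSet_centralWindowSet env c α)
          (J := fun g => (J U g : ℝ≥0∞)) (jac := fun g => (jac c env g : ℝ≥0∞))
          ((show Measurable (J U) from hJm.comp (measurable_const.prodMk measurable_id)).coe_nnreal_ennreal) (jacm env).coe_nnreal_ennreal
          hinjF hFS (hJlaw U) (hfwd c env)
        have hdens : ((fun g => (J U g : ℝ≥0∞)) * ((fun g => (jac c env g : ℝ≥0∞)) ∘ f)) =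
            fun g => ((J U g * jac c env (f g) : ℝ≥0) : ℝ≥0∞) := by
          funext g
          simp only [Pi.mul_apply, Function.comp_apply, ENNReal.coe_mul]
        rw [hdens] at key
        rw [hcomp, hW']
        exact key

end Summit.QuantumFields.YangMills.Theorems.FluctuationComparisonRegPrIntLS2BetaChartContBlindChain

end
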